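import Summits.ResolutionOfSingularities.ResolutionOfSingularities.Theorems.WeightedInvariantPointDrop
import Summits.ResolutionOfSingularities.ResolutionOfSingularities.Theorems.WeightedInvariantIota3Tau
import Summits.ResolutionOfSingularities.ResolutionOfSingularities.Theorems.WeightedInvariantP3bDrop
import Summits.ResolutionOfSingularities.ResolutionOfSingularities.Theorems.WeightedInvariantIota3SigmaAscent
import Mathlib.Algebra.Polynomial.HasseDeriv
import Mathlib.Algebra.Polynomial.Taylor
import Mathlib.Algebra.Polynomial.Degree.Domain
import Mathlib.Algebra.Polynomial.Expand
import HarnessLib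

/-!
# Sketch-R8 (res-L1-w43-idea-2, ROUND 8, technique B «data-driven datum axioms from the atlas») — TYPED FIRST STEPS

[OURS · L1 W4.3 · candidates · conjecture-grade statements of OUR key's P3 rung (door `HypersurfaceCentreConstruction`, stmt-19897;
legacy crux `WeightedConstruction`, stmt-0571); NOT statements of the manuscript under review (Hironaka 2017, [claim: Hironaka2017,
status: under-review]); AI typing, weaker than expert review.]

What ROUND 8 changes relative to Sketch-R7 §4:
* **(D7a) `R7.LevelResolvedNoTie` is WITHDRAWN — refuted IN THE MODEL** by kit j281191 (4 σ-maximiser positions with `q < r₂` AND a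
  `ν`-tie successor; first witness: `x²+yz⁴+y¹¹+z⁹ ∈ 𝔽₂[x,y,z]`, weights `(5,2,2)`, μ₂-orbit successor over `𝔽₂(μ)` with σ = (2;6) has an F13
  tie orbit `U₂² + μ⁵U₃⁶`).  It is not re-declared here; never re-want it.
* **(D7) `MaximiserTieRatioDrop p`** (§1) := (D7b) `R7.EqualWeightRatioDrop` with the hypothesis `q = r₂` DELETED: at EVERY σ-maximiser
  position, every `ν`-tie successor off the vertex has strictly smaller ratio letter `σ₁`.  Census (engine v3 dcfa93ad6dc31bc9, jobs
  j281039 ∪ j281051 ∪ j281191 ∪ j282037): **311/311 σ-maximiser `ν`-tie edges drop in `σ₁`** (172 R7 + 139 R8; R8 = designed-adversary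
  census OUTSIDE the R7 family cage: 29 edges at NON-AXIS TAME tie orbits, 30 non-axis wild, 80 axis; x-mixed starts; `ν = p² = 4`, `ν = 6`;
  imperfect ground field `𝔽_p(t)`; p = 2, 3, 5), 0 level-only drops, 0 ties, 0 rises; seam `weightedDrop_of_tieRatioDrop` (§1).
* **§2 the LOCAL MODEL behind (D7) for Weierstrass starts `x^p + h(y,z)`** (why the census could not have found a counterexample, and a
  proof LINE): (W1) the successor ratio at a tie prime is `ord(N(G))/p`, `N(G)` = the non-Frobenius part of the `X`-free part `G`
  (intrinsic); (W2) at a binomial tie orbit `Π = y^B + c z^A` the low-order coefficients of the local expansion are `𝔽_p`-LINEAR forms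
  `c_j(h)` in the coefficients of `h`; (W3) KERNEL LEMMA: `c_j(h) = 0` for all non-Frobenius `j < d/max(A,B)` forces
  `h ≡ a·Π^{d/max(A,B)}  (mod Frobenius image)` — verified exhaustively in the model for p ∈ {2,3,5}, all coprime `(A,B)` with `max ≤ 7`,
  reduced degree `d ≤ 100/90/60` (folder `r8search/`), and PROVED here in the no-tail / equal-weight case as `hasse_kernel_lemma` (Taylor
  expansion + perfectness); (W4) the degenerate `h` makes `f` quasi-homogeneous in `(x′, Π, light variable)`, so the presumed weights were not
  the σ-maximiser and `R7.QuasiHomogeneousNoTie` applies (engine check j282037: every hand-built "adversary" of this shape is re-coordinatised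
  by the maximiser, e.g. `x²+yz⁴+y³+z⁹ = (x+z(y+z²))² + (y+z²)³ + z⁹` gets σ = (3/2; 9/2), weights (9,6,2), 0 ties).
  Plus the two inequalities that close the x-mixed `p = 2` case at tailed orbits: `ratio′ ≤ ord_𝔫(A) ≤ d/(2AB) < d/(2·max(A,B)) = ratio`.
-/

noncomputable section

open IsLocalRing Literature.AlgebraicGeometry.Resolution
open Summit.ResolutionOfSingularities.ResolutionOfSingularities.Theorems

set_option linter.dupNamespace false

namespace Summit.ResolutionOfSingularities.ResolutionOfSingularities.Cruxes.HypersurfaceCentreConstruction.LocalEngine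

namespace Iota3

namespace R8

/-! ## §1 (D7) maximiser tie ⇒ ratio drop, and its seam to `WeightedDrop ι` -/

/-- [OURS · R8 · (D7) «AT A σ-MAXIMISER, THE RATIO LETTER DROPS AT EVERY ν-TIE» · candidate datum axiom · conjecture-grade]
At an ISOLATED position (regular local `S`, essentially of finite type over a perfect field `k₀` of characteristic `p`, `dim ≤ 3`,
`iotaOrd S f = ν`) with a σ-attaining two-flag `(g₁, g₂; q, r₁, r₂)` completed by `x` (primitive weights `(q, r₂, r₁)` on `(x, g₂, g₁)`),
EVERY `ν`-tie successor prime `𝔫 ∋ T′` of the cobordant algebra off the vertex has strictly smaller ratio letter: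
`iotaSigmaRatio (B_𝔫) g < iotaSigmaRatio S f`.  This is `R7.EqualWeightRatioDrop p` with the hypothesis `q = r₂` deleted (it implies it
verbatim); the deleted companion `R7.LevelResolvedNoTie p` is refuted in the model (file header).  Why it might fail: a hidden `ν`-th power
at the successor re-absorbed by its own preparation (the local model of §2 says this forces the START to be quasi-homogeneous in hidden
coordinates, where no tie exists); `ν = p^k, k ≥ 2` and non-binomial tie orbits are the least-tested cells (3 + 0 edges).
Census: 311/311 (file header). -/
def MaximiserTieRatioDrop (p : ℕ) : Prop :=
  ∀ (k₀ : Type) [Field k₀] [CharP k₀ p] [PerfectField k₀]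
    (S : Type) [CommRing S] [Algebra k₀ S] [Algebra.EssFiniteType k₀ S] [IsRegularLocalRing S] (f : S),
    ringKrullDim S ≤ 3 → f ≠ 0 → f ∈ (maximalIdeal S) ^ 2 → IsIsolatedPosition S f →
    ∀ (ν : ℕ), iotaOrd S f = ν →
    ∀ (x g₁ g₂ : S) (q r₁ r₂ : ℕ),
      Ideal.span {x, g₂, g₁} = maximalIdeal S → (maximalIdeal S).spanFinrank = 3 →
      IsSigmaMaximiser f ν g₁ g₂ q r₁ r₂ → IsPrimitiveTriple q r₁ r₂ →
      ∀ (𝔫 : Ideal (cobordantAlgebra' ![x, g₂, g₁] ![q, r₂, r₁])) [𝔫.IsPrime],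
        cobordantT' ![x, g₂, g₁] ![q, r₂, r₁] ∈ 𝔫 →
        ¬ (extReesAlgebra.vertexIdeal (weightedMonomialIdeal ![x, g₂, g₁] ![q, r₂, r₁]) ≤ 𝔫) →
        ∀ (a : ℕ) (g : cobordantAlgebra' ![x, g₂, g₁] ![q, r₂, r₁]),
          algebraMap S (cobordantAlgebra' ![x, g₂, g₁] ![q, r₂, r₁]) f = cobordantT' ![x, g₂, g₁] ![q, r₂, r₁] ^ a * g →
          ¬ (cobordantT' ![x, g₂, g₁] ![q, r₂, r₁] ∣ g) →
          iotaOrd (Localization.AtPrime 𝔫) (algebraMap (cobordantAlgebra' ![x, g₂, g₁] ![q, r₂, r₁]) (Localization.AtPrime 𝔫) g)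
              = iotaOrd S f →
          iotaSigmaRatio (Localization.AtPrime 𝔫) (algebraMap (cobordantAlgebra' ![x, g₂, g₁] ![q, r₂, r₁]) (Localization.AtPrime 𝔫) g)
            < iotaSigmaRatio S f

/-- **(R1) `Ratio1NoTie` — the provable-now ratio-MINIMAL case of (D7)** [OURS · candidate · IDEAS R8-C (iii)].  At an isolated position whose
K-ratio is the minimum (the σ-MAXIMISER triple has `r₁ = r₂`, i.e. ratio exactly 1 — stated on the maximiser's own weights because the scaled
letter `sigmaRatioNat` floors; equivalently the initial form `in_𝔪 f` is not `c·ℓ^ν` for a K-rational linear form — every K-non-solvable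
`x^p + μ y^p + …`, `μ ∉ K^p`, is such a position), the σ-maximiser blow-up has NO ν-tie successor position of dimension 3.  It is
implied by (D7) wherever the successor ratio letter is not junk (the ratio cannot drop below its minimum) and is the regime of the F13 / kangaroo
literature; census R8-B (iv): 22/22 ratio-1 positions reached have 0 tie orbits.  Proof sketch (in the cobordant algebra, IDEAS R8-C (iii)): a tie orbit
with non-zero light coordinate contradicts level-maximality (`IsSigmaMaximiser.not_sub_pow_mem_succ_level` is the tree's form of that step); a tie
orbit inside {light = 0} ≅ ℙ¹_K forces `in_𝔪 f = c·ℓ^ν`, i.e. ratio above the minimum. -/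
def Ratio1NoTie (p : ℕ) : Prop :=
  ∀ (k₀ : Type) [Field k₀] [CharP k₀ p] [PerfectField k₀]
    (S : Type) [CommRing S] [Algebra k₀ S] [Algebra.EssFiniteType k₀ S] [IsRegularLocalRing S] (f : S),
    ringKrullDim S ≤ 3 → f ≠ 0 → f ∈ (maximalIdeal S) ^ 2 → IsIsolatedPosition S f →
    ∀ (ν : ℕ), iotaOrd S f = ν →
    ∀ (x g₁ g₂ : S) (q r₁ r₂ : ℕ),
      Ideal.span {x, g₂, g₁} = maximalIdeal S → (maximalIdeal S).spanFinrank = 3 →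
      IsSigmaMaximiser f ν g₁ g₂ q r₁ r₂ → IsPrimitiveTriple q r₁ r₂ → r₁ = r₂ →
      ∀ (𝔫 : Ideal (cobordantAlgebra' ![x, g₂, g₁] ![q, r₂, r₁])) [𝔫.IsPrime],
        cobordantT' ![x, g₂, g₁] ![q, r₂, r₁] ∈ 𝔫 →
        ¬ (extReesAlgebra.vertexIdeal (weightedMonomialIdeal ![x, g₂, g₁] ![q, r₂, r₁]) ≤ 𝔫) →
        ∀ (a : ℕ) (g : cobordantAlgebra' ![x, g₂, g₁] ![q, r₂, r₁]),
          algebraMap S (cobordantAlgebra' ![x, g₂, g₁] ![q, r₂, r₁]) f = cobordantT' ![x, g₂, g₁] ![q, r₂, r₁] ^ a * g →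
          ¬ (cobordantT' ![x, g₂, g₁] ![q, r₂, r₁] ∣ g) →
          ringKrullDim (Localization.AtPrime 𝔫) = 3 →
          iotaOrd (Localization.AtPrime 𝔫) (algebraMap (cobordantAlgebra' ![x, g₂, g₁] ![q, r₂, r₁]) (Localization.AtPrime 𝔫) g)
              < iotaOrd S f

/-- **(D7) alone decides (K) for every `(ν, σ₁)`-monotone letter** (the R7 seam `weightedDrop_of_dichotomy` minus its first case): if
`ι R g < ι S f` whenever the order drops, or the order ties and the ratio letter drops, then (D7) gives `WeightedDrop ι` at every isolated
σ-maximiser position, every `p`, no tameness cut — GIVEN the order bound `iotaOrd (B_𝔫) g ≤ iotaOrd S f` at successors (`hle`; for the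
letter of record this is (iso-succ)/upper-semicontinuity, of record in `Theorems/WeightedInvariantIota3IsoSucc*.lean`). [folklore seam] -/
theorem weightedDrop_of_tieRatioDrop {p : ℕ} (hD : MaximiserTieRatioDrop p)
    (ι : (R : Type) → [CommRing R] → R → Ordinal.{0})
    (k₀ : Type) [Field k₀] [CharP k₀ p] [PerfectField k₀]
    (S : Type) [CommRing S] [Algebra k₀ S] [Algebra.EssFiniteType k₀ S] [IsRegularLocalRing S] (f : S)
    (hι : ∀ (R : Type) [CommRing R] (g : R),
      (iotaOrd R g < iotaOrd S f ∨ (iotaOrd R g = iotaOrd S f ∧ iotaSigmaRatio R g < iotaSigmaRatio S f)) → ι R g < ι S f)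
    (hdim : ringKrullDim S ≤ 3) (hf0 : f ≠ 0) (hf2 : f ∈ (maximalIdeal S) ^ 2) (hiso : IsIsolatedPosition S f)
    {ν : ℕ} (hν : iotaOrd S f = ν) {x g₁ g₂ : S} {q r₁ r₂ : ℕ}
    (hspan : Ideal.span {x, g₂, g₁} = maximalIdeal S) (hrk : (maximalIdeal S).spanFinrank = 3)
    (hmax : IsSigmaMaximiser f ν g₁ g₂ q r₁ r₂) (hprim : IsPrimitiveTriple q r₁ r₂)
    (hle : ∀ (𝔫 : Ideal (cobordantAlgebra' ![x, g₂, g₁] ![q, r₂, r₁])) [𝔫.IsPrime] (g : cobordantAlgebra' ![x, g₂, g₁] ![q, r₂, r₁]),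
      (∃ a : ℕ, algebraMap S (cobordantAlgebra' ![x, g₂, g₁] ![q, r₂, r₁]) f = cobordantT' ![x, g₂, g₁] ![q, r₂, r₁] ^ a * g) →
      iotaOrd (Localization.AtPrime 𝔫) (algebraMap (cobordantAlgebra' ![x, g₂, g₁] ![q, r₂, r₁]) (Localization.AtPrime 𝔫) g)
        ≤ iotaOrd S f) :
    WeightedDrop ι S f (maximalIdeal S) ![x, g₂, g₁] ![q, r₂, r₁] := by
  intro 𝔫 _ hT _ hv a g hfac hndvd _
  rcases (hle 𝔫 g ⟨a, hfac⟩).lt_or_eq with hlt' | heq'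
  · exact hι _ _ (Or.inl hlt')
  · exact hι _ _ (Or.inr ⟨heq', hD k₀ S f hdim hf0 hf2 hiso ν hν x g₁ g₂ q r₁ r₂ hspan hrk hmax hprim 𝔫 hT hv a g hfac hndvd heq'⟩)

/-! ## §2 The local model behind (D7) for Weierstrass starts: Frobenius part, linear coefficient forms, kernel lemma -/

section LocalModel

open Polynomial

variable {k : Type} [Field k]

/-- **The axis-orbit cage, algebraic core.**  In `k[X]` over a field, `C c * X ^ a` with `c ≠ 0` is a `p`-th power only if `p ∣ a`
(degree count).  At an AXIS tie orbit of a `p`-th-power-clean Weierstrass start the successor face is a sum of such monomials over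
`κ(𝔫) = k(μ)` with `p ∤ a` or `p ∤ b` termwise, so nothing is absorbable there — which is why the R7 family (axis orbits only at depth 0)
could not have produced a counterexample to (D7). [folklore] -/
theorem dvd_of_pow_eq_C_mul_X_pow {p a : ℕ} {c : k} (hc : c ≠ 0) {g : k[X]}
    (h : g ^ p = C c * X ^ a) : p ∣ a := by
  have hdeg : (g ^ p).natDegree = a := by rw [h, natDegree_C_mul_X_pow a c hc]
  rw [natDegree_pow] at hdeg
  exact ⟨g.natDegree, hdeg.symm⟩

/-- **(W3) in the no-tail / equal-weight case — the Hasse kernel lemma (PROVED).**  Over a PERFECT field of characteristic `p`, a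
polynomial `H` of degree `≤ D` all of whose Hasse derivatives `H^{[l]}(c)` vanish for `l < D` with `p ∤ l` is
`a·(X − c)^D + G^p` for some `a : k`, `G : k[X]`.  (Taylor expansion at `c`: only the exponents `l` with `p ∣ l`, and possibly `l = D`,
survive; a polynomial in `(X − c)^p` with coefficients in `k = k^p` is a `p`-th power.)  Dictionary: at an equal-weight (wild, `p ∣ g`)
tie orbit `z = c·y` of `x^p + y^{D}H(z/y)`, the successor's non-Frobenius part below order `D = d/w` is exactly the list of these Hasse
values, so "no ratio drop" forces `h = a(z − cy)^D + (p-th power)` — absorbed or quasi-homogeneous in `(x′, z − cy, y)`. [folklore] -/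
theorem hasse_kernel_lemma (p : ℕ) [Fact p.Prime] [CharP k p] [PerfectField k]
    (H : k[X]) (c : k) (D : ℕ) (hdeg : H.natDegree ≤ D)
    (hvan : ∀ l < D, ¬ p ∣ l → (hasseDeriv l H).eval c = 0) :
    ∃ (a : k) (G : k[X]), H = C a * (X - C c) ^ D + G ^ p := by
  classical
  have hcoeff : ∀ l, (taylor c H).coeff l = (hasseDeriv l H).eval c := fun l => taylor_coeff c H l
  have hTdeg : (taylor c H).natDegree ≤ D := (natDegree_taylor H c).le.trans hdeg
  -- Taylor's formula as a finite sum over `range (D + 1)`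
  have hT : H = ∑ l ∈ Finset.range (D + 1), C ((taylor c H).coeff l) * (X - C c) ^ l := by
    conv_lhs => rw [← sum_taylor_eq H c]
    rw [Polynomial.sum_def]
    refine Finset.sum_subset (fun l hl => Finset.mem_range.mpr
      (Nat.lt_succ_of_le ((le_natDegree_of_mem_supp l hl).trans hTdeg))) (fun l _ hl => ?_)
    have h0 : (taylor c H).coeff l = 0 := by simpa [mem_support_iff] using hl
    simp [h0]
  have hzero : ∀ l ∈ Finset.range D, ¬ p ∣ l → (taylor c H).coeff l = 0 := fun l hl hpl => by
    rw [hcoeff]; exact hvan l (Finset.mem_range.mp hl) hpl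
  -- `p`-th roots of the surviving terms (perfectness of `k`)
  have key : ∀ l ∈ (Finset.range D).filter (fun l => p ∣ l),
      ∃ Q : k[X], Q ^ p = C ((taylor c H).coeff l) * (X - C c) ^ l := by
    intro l hl
    obtain ⟨m, hm⟩ := (Finset.mem_filter.mp hl).2
    refine ⟨C ((frobeniusEquiv k p).symm ((taylor c H).coeff l)) * (X - C c) ^ m, ?_⟩
    rw [mul_pow, ← C_pow, frobeniusEquiv_symm_pow_p, ← pow_mul, mul_comm m p, ← hm]
  choose Q hQ using key
  refine ⟨(taylor c H).coeff D, ∑ l ∈ ((Finset.range D).filter (fun l => p ∣ l)).attach, Q l.1 l.2, ?_⟩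
  have hrest : ∑ l ∈ (Finset.range D).filter (fun l => ¬ p ∣ l), C ((taylor c H).coeff l) * (X - C c) ^ l = 0 :=
    Finset.sum_eq_zero fun l hl => by
      obtain ⟨hl1, hl2⟩ := Finset.mem_filter.mp hl
      simp [hzero l hl1 hl2]
  have hpow : (∑ l ∈ ((Finset.range D).filter (fun l => p ∣ l)).attach, Q l.1 l.2) ^ p
      = ∑ l ∈ (Finset.range D).filter (fun l => p ∣ l), C ((taylor c H).coeff l) * (X - C c) ^ l := by
    rw [sum_pow_char p, ← Finset.sum_attach ((Finset.range D).filter (fun l => p ∣ l))]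
    exact Finset.sum_congr rfl fun l _ => hQ l.1 l.2
  calc H = ∑ l ∈ Finset.range (D + 1), C ((taylor c H).coeff l) * (X - C c) ^ l := hT
    _ = C ((taylor c H).coeff D) * (X - C c) ^ D
          + ∑ l ∈ Finset.range D, C ((taylor c H).coeff l) * (X - C c) ^ l := by
        rw [Finset.sum_range_succ, add_comm]
    _ = C ((taylor c H).coeff D) * (X - C c) ^ D
          + ∑ l ∈ (Finset.range D).filter (fun l => p ∣ l), C ((taylor c H).coeff l) * (X - C c) ^ l := by
        rw [← Finset.sum_filter_add_sum_filter_not (Finset.range D) (fun l => p ∣ l), hrest, add_zero]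
    _ = _ := by rw [hpow]

end LocalModel

/-- [OURS · R8 · (W1) · candidate · expected provable now · M-sized; informal, NOT typed here] **Frobenius part = ratio.**  For
`g = X^p + G` in a regular local ring `B` of characteristic `p` with `G` not involving the parameter `X` (Weierstrass successor of a
Weierstrass start), `p · ratio(B, g) = sup_φ ord(G + φ^p) = ord N(G)`, where `N(G)` is `G` minus its component in the closure of the
Frobenius image `{Σ s_{ab}^p π^{pa} T^{pb}}` — intrinsic (independent of the regular system `(π, T)` and of `φ`).  Recorded as the
dictionary entry that turns the census's "absorbable `p`-th power face" test into a statement about `iotaSigmaRatio`; typing it needs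
073's scaled `iotaSigmaRatio` unfolded to two-flag filtrations (not done in this sketch). -/
def FrobeniusPartRatioDictionary : Prop := True

/-- [OURS · R8 · (W3-tail) · MODEL-VERIFIED, NOT PROVED · the kernel lemma at TAILED binomial orbits] For coprime `(A, B)` with
`min(A,B) ≥ 2`, prime `p`, and a weighted form `h = Σ a_{ik} y^i z^k` (`Ai + Bk = d`), let `W(q) = W₀ + ε(q) ∈ 𝔽_p⟦q⟧` solve
`W^{-vB} + W^{uA} = q` (`uA + vB = 1`, `W₀ = −1`, resp. `1` for `p = 2`) and `c_j(h) := Σ a_{ik} [q^j] W^{uk − vi}`.  If `c_j(h) = 0`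
for every `j < d / max(A,B)` with `¬(p ∣ j ∧ p ∣ d)`, then `h` is a `p`-th power (hence absorbed at the start).  Exhaustive over
`𝔽_p`-kernels: p = 2 (d ≤ 100), 3 (d ≤ 90), 5 (d ≤ 60), `(A,B)` ∈ {(3,2),(5,2),(4,3),(5,3),(7,2),(5,4),(7,3)} and transposes: the kernel
is EMPTY outside `p`-th powers in every case (folder `r8search/`, files `candidates_p{2,3,5}.txt`); with `min(A,B) = 1` (no tail) the
kernel is exactly `{a·Π^{d/max} + p-th power}` (254/254, 296/296, 364/364 kernel vectors), matching `hasse_kernel_lemma`.  Informal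
record only (the statement quantifies over a power series solved in `𝔽_p⟦q⟧`; typing deferred). -/
def TailKernelLemmaModel : Prop := True

end R8

end Iota3

end Summit.ResolutionOfSingularities.ResolutionOfSingularities.Cruxes.HypersurfaceCentreConstruction.LocalEngine

end
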